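import Mathlib
import Summits.ResolutionOfSingularities.ResolutionOfSingularities.Theorems.HomologicalConductorSurfaceTerminationReduction
import Summits.ResolutionOfSingularities.ResolutionOfSingularities.Theorems.HomologicalConductorNoZenoRHighDimDoor
import Summits.ResolutionOfSingularities.ResolutionOfSingularities.Theorems.HomologicalConductorNoZenoSurfaceCoreFourFacts
import HarnessLib

/-!
# Kill test `SurfaceTermination` (stmt-16488) and cruxes `NoZenoR` (stmt-19943) / `StrictDrop` (stmt-16485):
# the dichotomy reduction and the crux doors modulo FOUR prints

Route `ResolutionOfSingularities/HomologicalConductor` (cell decomp-res, hand leafhand-res-homologicalconduct-3 g1).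
OURS: AI-written, weaker than expert review; nothing here is a statement of the manuscript under review
(Hironaka 2017).  SUPPORT level, counted 0.  Def-free, no new named facts.

The reduction of record (`…SurfaceTerminationReduction`, res-L0-w44-stub-3) and the crux door of record
(`…NoZenoRHighDimDoor.noZenoR_of_facts_of_topDim`, hand-3 g0) are stated modulo the registered six-fact bundle.  Since
the surface core holds modulo the FOUR-fact bundle `CJS2020General ∧ Lipman1969_1_2 ∧ Lipman1969_4_1 ∧ Lipman1969_12_1_ii`
(`FourFacts.sandwichedTermination_of_facts4`: Görtz–Wedhorn 24.44 discharged by the tree theorem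
`NoZeno.gwH2ResolutionDim2_holds`, Lipman (12.1)(i) idle), so do they (proofs verbatim those of record):

* `exhaustiveSurfaceTermination_of_facts4` (c1), `surfaceTermination_of_primeDivisorCase_of_facts4`,
  **`surfaceTermination_iff_primeDivisorCase_of_facts4`** (c2: modulo four prints the kill test ⟺ its prime-divisor
  case (D-s)), **`surfaceTermination_of_strictDrop4`** (c3: `StrictDrop → SurfaceTermination` modulo four prints);
* **`noZenoR_of_facts4_of_topDim`** — the crux `NoZenoR` BY NAME from the four prints + (TOP) «under `StrictDrop`, every
  admissible datum of dimension `≥ 3` whose canonical tower keeps the top dimension reaches a regular stage»;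
* `strictDrop_of_facts4_of_primeDivisorCase_of_topDim'`, `noZenoR_of_facts4_of_primeDivisorCase_of_topDim'` — without
  `StrictDrop` anywhere: both open cruxes from the four prints + (D-s) + (TOP′).

EXACT REMAINING PRINT DEBT of the kill-test / crux doors after this file: Cossart–Jannsen–Saito 2020 Thm 1.2
(`CossartJannsenSaito2020General`), Lipman 1969 Prop. (1.2) (`Lipman1969_1_2`), Thm. (4.1) (`Lipman1969_4_1`),
Thm. (12.1)(ii) (`Lipman1969_12_1_ii`).  The registered by-name bundles (`stub_publishedSurfaceFacts`,
`stub_publishedSurfaceFactsW3`) are texts of record and are NOT changed by this file.  No crux, kill test or summit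
statement is proved here; resolution of singularities in positive characteristic is NOT proved.
-/

-- single-problem summit: the doubled namespace component `ResolutionOfSingularities` is forced
set_option linter.dupNamespace false

noncomputable section

open Summit.ResolutionOfSingularities.ResolutionOfSingularities.Theses.HomologicalConductor
open Summit.ResolutionOfSingularities.ResolutionOfSingularities.Theorems
open Summit.ResolutionOfSingularities.ResolutionOfSingularities.Theorems.NoZeno.Birth
open Summit.ResolutionOfSingularities.ResolutionOfSingularities.Theorems.NoZeno.SandwichCluster
open Literature.AlgebraicGeometry.Resolution

namespace Summit.ResolutionOfSingularities.ResolutionOfSingularities.Theorems.SurfaceTermination.Reduction.FourFacts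

/-! ## (c1) Exhaustive surface towers terminate, modulo four prints -/

/-- **(c1) An EXHAUSTING surface tower reaches a regular stage, modulo four prints** (twin of
`exists_regular_of_exhausts_of_facts`): local uniformization from CJS 2020 puts a regular local `R ⊆ O` with
`Frac R = K`, `loc O R = R` inside every late stage, and the sandwiched tower terminates
(`FourFacts.sandwichedTermination_of_facts4`). [cite: CossartJannsenSaito2020, Thm. 1.2] [cite: Spivakovsky1990, §II] -/
theorem exists_regular_of_exhausts_of_facts4
    (hF : (Literature.AlgebraicGeometry.Resolution.CossartJannsenSaito2020General.{0} ∧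
      Literature.AlgebraicGeometry.Resolution.Lipman1969_1_2.{0} ∧
      Literature.AlgebraicGeometry.Resolution.Lipman1969_4_1.{0} ∧
      Literature.AlgebraicGeometry.Resolution.Lipman1969_12_1_ii.{0}))
    (p : ℕ) (hp : p.Prime) (k K : Type) [Field k] [CharP k p] [Field K] [Algebra k K]
    (O : ValuationSubring K) (A : Subalgebra k K) (hk : ∀ c : k, algebraMap k K c ∈ O) (hA : A.FG)
    (hfr : IsFractionRing ↥A K) (hAO : A.toSubring ≤ O.toSubring) (htr : Algebra.trdeg k K = 2)
    (hexh : ∀ x : K, x ∈ O → ∃ m : ℕ, x ∈ tower O A m) :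
    ∃ m : ℕ, IsRegularLocalRing ↥(tower O A m) := by
  haveI := hfr
  haveI : Algebra.FiniteType k ↥A := A.fg_iff_finiteType.mp hA
  have hfg : (⊤ : IntermediateField k K).FG :=
    IntermediateField.fg_top_of_isFractionRing_of_finiteType k ↥A K
  have hLU : IsLocallyUniformizable k K O :=
    stub_surfaceLU_of_cossartJannsenSaito2020
      (CossartJannsenSaito2020General.cossartJannsenSaito2020_holds_of hF.1) k K hfg htr.le O hk
  obtain ⟨R, hR, hRfr, hRO, hlocR, m₀, hm₀⟩ :=
    exh_exists_regular_le_tower_of_isLocallyUniformizable O A hk hAO hexh hLU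
  exact FourFacts.sandwichedTermination_of_facts4 hF p hp k K O A R m₀ ⟨hk, hA, hfr, hAO, htr, hR, hRfr, hRO, hlocR, hm₀⟩

/-- **(c1) by name, modulo four prints: `ExhaustiveSurfaceTermination`.**
[cite: CossartJannsenSaito2020, Thm. 1.2] [cite: Spivakovsky1990, §II] -/
theorem exhaustiveSurfaceTermination_of_facts4
    (hF : (Literature.AlgebraicGeometry.Resolution.CossartJannsenSaito2020General.{0} ∧
      Literature.AlgebraicGeometry.Resolution.Lipman1969_1_2.{0} ∧
      Literature.AlgebraicGeometry.Resolution.Lipman1969_4_1.{0} ∧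
      Literature.AlgebraicGeometry.Resolution.Lipman1969_12_1_ii.{0})) :
    ExhaustiveSurfaceTermination :=
  fun p hp k K _ _ _ _ O A hk hA hfr hAO htr hexh =>
    exists_regular_of_exhausts_of_facts4 hF p hp k K O A hk hA hfr hAO htr hexh

/-! ## (c2) `SurfaceTermination` ⟺ its prime-divisor case, modulo four prints -/

/-- **(c2) modulo four prints: the prime-divisor case (D-s) implies `SurfaceTermination`.**
[cite: ZariskiSamuel1960, Ch. VI §14, Thm. 31] -/
theorem surfaceTermination_of_primeDivisorCase_of_facts4
    (hF : (Literature.AlgebraicGeometry.Resolution.CossartJannsenSaito2020General.{0} ∧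
      Literature.AlgebraicGeometry.Resolution.Lipman1969_1_2.{0} ∧
      Literature.AlgebraicGeometry.Resolution.Lipman1969_4_1.{0} ∧
      Literature.AlgebraicGeometry.Resolution.Lipman1969_12_1_ii.{0}))
    (hDs : PrimeDivisorSurfaceTermination) : SurfaceTermination :=
  surfaceTermination_of_primeDivisorCase (exhaustiveSurfaceTermination_of_facts4 hF) hDs

/-- **Modulo FOUR prints, the kill test `SurfaceTermination` (stmt-16488) is EQUIVALENT to its prime-divisor special
case (D-s)** «along a prime divisor of the function field of a surface, the canonical normalised `ca`-tower of a
two-dimensional affine model reaches a regular stage» (twin of `surfaceTermination_iff_primeDivisorCase_of_facts`).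
[cite: ZariskiSamuel1960, Ch. VI §14, Thm. 31] -/
theorem surfaceTermination_iff_primeDivisorCase_of_facts4
    (hF : (Literature.AlgebraicGeometry.Resolution.CossartJannsenSaito2020General.{0} ∧
      Literature.AlgebraicGeometry.Resolution.Lipman1969_1_2.{0} ∧
      Literature.AlgebraicGeometry.Resolution.Lipman1969_4_1.{0} ∧
      Literature.AlgebraicGeometry.Resolution.Lipman1969_12_1_ii.{0})) :
    SurfaceTermination ↔ PrimeDivisorSurfaceTermination :=
  surfaceTermination_iff_primeDivisorCase (exhaustiveSurfaceTermination_of_facts4 hF)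

/-! ## (c3) `StrictDrop ⇒ SurfaceTermination`, modulo four prints -/

/-- **(c3) `StrictDrop → SurfaceTermination` modulo FOUR prints** (twin of `surfaceTermination_of_strictDrop`): by (c2)
only the prime-divisor case is left, and there `StrictDrop` terminates the tower (a prime divisor is a DVR:
`primeDivisorSurfaceTermination_of_strictDrop`, fact-free). [cite: ZariskiSamuel1960, Ch. VI §10] -/
theorem surfaceTermination_of_strictDrop4
    (hF : (Literature.AlgebraicGeometry.Resolution.CossartJannsenSaito2020General.{0} ∧
      Literature.AlgebraicGeometry.Resolution.Lipman1969_1_2.{0} ∧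
      Literature.AlgebraicGeometry.Resolution.Lipman1969_4_1.{0} ∧
      Literature.AlgebraicGeometry.Resolution.Lipman1969_12_1_ii.{0}))
    (hD : StrictDrop) : SurfaceTermination :=
  surfaceTermination_of_primeDivisorCase_of_facts4 hF (primeDivisorSurfaceTermination_of_strictDrop hD)

/-! ## The crux doors modulo four prints -/

/-- **`NoZenoR` (stmt-19943) BY NAME ⟸ FOUR prints + (TOP)** (twin of `HighDimDoor.noZenoR_of_facts_of_topDim`): the kill
test comes from `StrictDrop` (available inside `NoZenoR`) by `surfaceTermination_of_strictDrop4`; the rest is the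
fact-free door `HighDimDoor.noZenoR_of_surfaceTermination_of_topDim` (stage dimension eventually constant; `≤ 2` by the
kill test; `≥ 3` re-grounded into a top-dimensional datum = (TOP)).
[cite: Lipman1969, Proposition (1.2), Theorem (4.1), Theorem (12.1) (ii)] [cite: CossartJannsenSaito2020, Thm. 1.2] -/
theorem noZenoR_of_facts4_of_topDim
    (hF : (Literature.AlgebraicGeometry.Resolution.CossartJannsenSaito2020General.{0} ∧
      Literature.AlgebraicGeometry.Resolution.Lipman1969_1_2.{0} ∧
      Literature.AlgebraicGeometry.Resolution.Lipman1969_4_1.{0} ∧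
      Literature.AlgebraicGeometry.Resolution.Lipman1969_12_1_ii.{0}))
    (hTop : StrictDrop → ∀ p : ℕ, p.Prime → ∀ (k K : Type) [Field k] [CharP k p] [Field K] [Algebra k K]
      (O : ValuationSubring K) (A : Subalgebra k K), (∀ c : k, algebraMap k K c ∈ O) → A.FG →
      IsFractionRing ↥A K → A.toSubring ≤ O.toSubring → ¬ ringKrullDim ↥A ≤ 2 →
      (∀ n : ℕ, ringKrullDim ↥(tower O A n) = ringKrullDim ↥A) → ∃ m : ℕ, IsRegularLocalRing ↥(tower O A m)) :
    NoZenoR := by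
  by_cases hD : StrictDrop
  · exact HighDimDoor.noZenoR_of_surfaceTermination_of_topDim (surfaceTermination_of_strictDrop4 hF hD) hTop
  · exact fun _ hD' => absurd hD' hD

/-- **`StrictDrop` (stmt-16485) BY NAME ⟸ FOUR prints + (D-s) + (TOP′)** — without `StrictDrop` as a hypothesis: the
kill test from (D-s) by (c2), then the fact-free door `HighDimDoor.strictDrop_of_surfaceTermination_of_topDim'`.
[cite: ZariskiSamuel1960, Ch. VI §14, Thm. 31] [cite: Lipman1969, (1.2), (4.1), (12.1)(ii)] -/
theorem strictDrop_of_facts4_of_primeDivisorCase_of_topDim'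
    (hF : (Literature.AlgebraicGeometry.Resolution.CossartJannsenSaito2020General.{0} ∧
      Literature.AlgebraicGeometry.Resolution.Lipman1969_1_2.{0} ∧
      Literature.AlgebraicGeometry.Resolution.Lipman1969_4_1.{0} ∧
      Literature.AlgebraicGeometry.Resolution.Lipman1969_12_1_ii.{0}))
    (hDs : PrimeDivisorSurfaceTermination)
    (hTop : ∀ p : ℕ, p.Prime → ∀ (k K : Type) [Field k] [CharP k p] [Field K] [Algebra k K]
      (O : ValuationSubring K) (A : Subalgebra k K), (∀ c : k, algebraMap k K c ∈ O) → A.FG →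
      IsFractionRing ↥A K → A.toSubring ≤ O.toSubring → ¬ ringKrullDim ↥A ≤ 2 →
      (∀ n : ℕ, ringKrullDim ↥(tower O A n) = ringKrullDim ↥A) → ∃ m : ℕ, IsRegularLocalRing ↥(tower O A m)) :
    StrictDrop :=
  HighDimDoor.strictDrop_of_surfaceTermination_of_topDim'
    (surfaceTermination_of_primeDivisorCase_of_facts4 hF hDs) hTop

/-- **`NoZenoR` (stmt-19943) BY NAME ⟸ FOUR prints + (D-s) + (TOP′)** — the same door for the rank-2 crux, through the
fact-free `HighDimDoor.noZenoR_of_surfaceTermination_of_topDim'`.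
[cite: ZariskiSamuel1960, Ch. VI §14, Thm. 31] [cite: Lipman1969, (1.2), (4.1), (12.1)(ii)] -/
theorem noZenoR_of_facts4_of_primeDivisorCase_of_topDim'
    (hF : (Literature.AlgebraicGeometry.Resolution.CossartJannsenSaito2020General.{0} ∧
      Literature.AlgebraicGeometry.Resolution.Lipman1969_1_2.{0} ∧
      Literature.AlgebraicGeometry.Resolution.Lipman1969_4_1.{0} ∧
      Literature.AlgebraicGeometry.Resolution.Lipman1969_12_1_ii.{0}))
    (hDs : PrimeDivisorSurfaceTermination)
    (hTop : ∀ p : ℕ, p.Prime → ∀ (k K : Type) [Field k] [CharP k p] [Field K] [Algebra k K]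
      (O : ValuationSubring K) (A : Subalgebra k K), (∀ c : k, algebraMap k K c ∈ O) → A.FG →
      IsFractionRing ↥A K → A.toSubring ≤ O.toSubring → ¬ ringKrullDim ↥A ≤ 2 →
      (∀ n : ℕ, ringKrullDim ↥(tower O A n) = ringKrullDim ↥A) → ∃ m : ℕ, IsRegularLocalRing ↥(tower O A m)) :
    NoZenoR :=
  HighDimDoor.noZenoR_of_surfaceTermination_of_topDim'
    (surfaceTermination_of_primeDivisorCase_of_facts4 hF hDs) hTop

/-! ## The sharper residual: only KERNEL data (no noetherian weak dominator) of top dimension ≥ 3 are left -/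

/-- **`NoZenoR` (stmt-19943) BY NAME ⟸ FOUR prints + (TOP-ker)** — the door `noZenoR_of_facts4_of_topDim` with its
residual (TOP) cut down by NOETHERIAN CAPTURE: under `StrictDrop`, a datum whose tower is weakly dominated by a NOETHERIAN
valuation ring `O'` terminates for free (the `O'`-tower IS the `O`-tower, `stub_dominanceInvariance`, and `StrictDrop` along the
noetherian `O'` cannot drop for ever, `stub_noetherianCase`).  So the residual is
(TOP-ker): «under `StrictDrop`, NO admissible datum with `dim A ≥ 3`, all of whose stages keep the Krull dimension `dim A`, has
ONLY non-noetherian weak dominators» — the kernel binder `hker` of the registered v34 kernel stubs, restricted to top-dimensional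
towers of dimension `≥ 3` (in transcendence degree 3: zero-dimensional non-divisorial valuations with closed-point centres).
[cite: ZariskiSamuel1960, Ch. VI §10] [cite: Lipman1969, (1.2), (4.1), (12.1)(ii)] [cite: CossartJannsenSaito2020, Thm. 1.2] -/
theorem noZenoR_of_facts4_of_topKernel
    (hF : (Literature.AlgebraicGeometry.Resolution.CossartJannsenSaito2020General.{0} ∧
      Literature.AlgebraicGeometry.Resolution.Lipman1969_1_2.{0} ∧
      Literature.AlgebraicGeometry.Resolution.Lipman1969_4_1.{0} ∧
      Literature.AlgebraicGeometry.Resolution.Lipman1969_12_1_ii.{0}))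
    (hKer : StrictDrop → ∀ p : ℕ, p.Prime → ∀ (k K : Type) [Field k] [CharP k p] [Field K] [Algebra k K]
      (O : ValuationSubring K) (A : Subalgebra k K), (∀ c : k, algebraMap k K c ∈ O) → A.FG →
      IsFractionRing ↥A K → A.toSubring ≤ O.toSubring → ¬ ringKrullDim ↥A ≤ 2 →
      (∀ n : ℕ, ringKrullDim ↥(tower O A n) = ringKrullDim ↥A) →
      ¬ (∀ O' : ValuationSubring K,
        (∀ m : ℕ, ∀ s ∈ tower O A m, s ∈ O' ∧ (s⁻¹ ∈ O' → s⁻¹ ∈ O)) → ¬ IsNoetherianRing ↥O')) :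
    NoZenoR := by
  refine noZenoR_of_facts4_of_topDim hF fun hD p hp k K _ _ _ _ O A hk hA hfr hAO hnot htop => ?_
  -- by (TOP-ker) some weak dominator `O'` of the tower is noetherian
  have hex : ∃ O' : ValuationSubring K, IsNoetherianRing ↥O' ∧
      ∀ m : ℕ, ∀ s ∈ tower O A m, s ∈ O' ∧ (s⁻¹ ∈ O' → s⁻¹ ∈ O) := by
    by_contra hno
    exact hKer hD p hp k K O A hk hA hfr hAO hnot htop fun O' hdom hN => hno ⟨O', hN, hdom⟩
  obtain ⟨O', hN, hdom⟩ := hex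
  -- the `O'`-tower is the `O`-tower, and `StrictDrop` terminates it along the noetherian `O'`
  have hTeq : ∀ m : ℕ, tower O' A m = tower O A m := fun m =>
    stub_dominanceInvariance k K O O' A hk hAO
      (fun n => stub_towerNoetherian k K O A hk hA hfr hAO n) hdom m
  have hk' : ∀ c : k, algebraMap k K c ∈ O' :=
    fun c => (hdom 0 _ ((tower O A 0).algebraMap_mem c)).1
  have hAO' : A.toSubring ≤ O'.toSubring :=
    fun a ha => (hdom 0 a (mem_tower_of_mem O A 0 a ha)).1
  obtain ⟨m, hm⟩ := stub_noetherianCase hD p hp k K O' A hk' hA hfr hAO' hN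
  exact ⟨m, hTeq m ▸ hm⟩

/-- **(TOP-ker) is NECESSARY** (fact-free): `NoZenoR` implies (TOP-ker) — indeed it implies that under `StrictDrop` NO
admissible datum at all has only non-noetherian weak dominators: `NoZenoR` + `StrictDrop` (+ `PersistenceRadical`, a tree
theorem) terminate every tower, and a regular stage has a discrete weak dominator (`DiscreteDominator.not_isRegularLocalRing_of_kernel`).
[this work; composition of tree results] -/
theorem topKernel_of_noZenoR (h : NoZenoR) :
    StrictDrop → ∀ p : ℕ, p.Prime → ∀ (k K : Type) [Field k] [CharP k p] [Field K] [Algebra k K]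
      (O : ValuationSubring K) (A : Subalgebra k K), (∀ c : k, algebraMap k K c ∈ O) → A.FG →
      IsFractionRing ↥A K → A.toSubring ≤ O.toSubring → ¬ ringKrullDim ↥A ≤ 2 →
      (∀ n : ℕ, ringKrullDim ↥(tower O A n) = ringKrullDim ↥A) →
      ¬ (∀ O' : ValuationSubring K,
        (∀ m : ℕ, ∀ s ∈ tower O A m, s ∈ O' ∧ (s⁻¹ ∈ O' → s⁻¹ ∈ O)) → ¬ IsNoetherianRing ↥O') := by
  intro hD p hp k K _ _ _ _ O A hk hA hfr hAO _ _ hker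
  obtain ⟨M, hM⟩ := NoZeno.DiscreteDominator.noZenoR_iff.mp h
    Theorems.persistenceRadical_proof hD p hp k K O A hk hA hfr hAO
  exact NoZeno.DiscreteDominator.not_isRegularLocalRing_of_kernel O A hk hfr hAO hker M hM

/-- **THE EXACT RESIDUAL OF THE CRUX `NoZenoR` MODULO FOUR PRINTS, kernel form**: given CJS 2020 Thm 1.2 and Lipman (1.2),
(4.1), (12.1)(ii), `NoZenoR` ⟺ (TOP-ker) «under `StrictDrop`, no admissible datum with `dim A ≥ 3` and top-dimensional tower has
only non-noetherian weak dominators».  (`←` is `noZenoR_of_facts4_of_topKernel`; `→` is the fact-free `topKernel_of_noZenoR`.)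
[cite: Lipman1969, (1.2), (4.1), (12.1)(ii)] [cite: CossartJannsenSaito2020, Thm. 1.2] -/
theorem noZenoR_iff_topKernel_of_facts4
    (hF : (Literature.AlgebraicGeometry.Resolution.CossartJannsenSaito2020General.{0} ∧
      Literature.AlgebraicGeometry.Resolution.Lipman1969_1_2.{0} ∧
      Literature.AlgebraicGeometry.Resolution.Lipman1969_4_1.{0} ∧
      Literature.AlgebraicGeometry.Resolution.Lipman1969_12_1_ii.{0})) :
    NoZenoR ↔
      (StrictDrop → ∀ p : ℕ, p.Prime → ∀ (k K : Type) [Field k] [CharP k p] [Field K] [Algebra k K]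
        (O : ValuationSubring K) (A : Subalgebra k K), (∀ c : k, algebraMap k K c ∈ O) → A.FG →
        IsFractionRing ↥A K → A.toSubring ≤ O.toSubring → ¬ ringKrullDim ↥A ≤ 2 →
        (∀ n : ℕ, ringKrullDim ↥(tower O A n) = ringKrullDim ↥A) →
        ¬ (∀ O' : ValuationSubring K,
          (∀ m : ℕ, ∀ s ∈ tower O A m, s ∈ O' ∧ (s⁻¹ ∈ O' → s⁻¹ ∈ O)) → ¬ IsNoetherianRing ↥O')) :=
  ⟨topKernel_of_noZenoR, noZenoR_of_facts4_of_topKernel hF⟩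

end Summit.ResolutionOfSingularities.ResolutionOfSingularities.Theorems.SurfaceTermination.Reduction.FourFacts

end
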